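import Mathlib.Analysis.Matrix.Spectrum
import Literature.LinearAlgebra.Matrix.PerronSymmetric
import Summits.Ventures.YMGap.FlowData.MatrixFreeLevelCertificate
import HarnessLib

/-!
# Frobenius deflation bound and the SELF-ISOLATED level certificate (FLOW-DATA, route O)

HONEST FRAMING: pure finite-dimensional linear algebra for a real symmetric matrix `A`. In the FLOW-DATA
track (d = 4, 2×1×1 × ∞ tube, lineage A-t211, matrix-free solver «route O») `A` is a symmetry block
`P W_{S,T} P` of the truncated kept-set transfer block; nothing here is a continuum, infinite-volume or
mass-gap statement.

The level certificate of `MatrixFreeLevelCertificate` encloses the `k`-th largest eigenvalue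
`λ↓_k(A)` in a residual ball `[μ − ρ, μ + ρ]` PROVIDED the ball is isolated by index: every `λ↓_j` with
`j > k` certified below `μ − ρ` and every `λ↓_j` with `j < k` certified above `μ + ρ`. There the
isolation came from a REFERENCE dense computation of the same matrix (certified neighbours). This file
supplies the isolation from the matrix-free run's OWN data, so that a matrix-free point needs no dense
companion:

* §1 `sum_sq_eq_sum_eigenvalues₀_sq` — **`Σ_{i,l} A_{il}² = Σ_j λ↓_j(A)²`** (the Frobenius norm of a real
  symmetric matrix is the ℓ²-norm of its spectrum; spectral theorem, via the tree's
  `Literature.LinearAlgebra.Matrix.trace_pow_eq_sum`). [cite: HornJohnson2013, Thm 2.5.3 (c)]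
* §2 `eigenvalues₀_sq_le_of_frobenius` — **FROBENIUS DEFLATION BOUND**: if `Σ_{i,l} A_{il}² ≤ U` and
  `0 ≤ m_j ≤ λ↓_j(A)` for the indices `j` of a finite set `s`, then for every index `j₁ ∉ s`,
  `λ↓_{j₁}(A)² ≤ U − Σ_{j ∈ s} m_j²`; hence `λ↓_{j₁}(A) ≤ √(U − Σ_{j∈s} m_j²)`
  (`eigenvalues₀_le_sqrt_of_frobenius`) and `λ↓_{j₁}(A) < lo` as soon as `U − Σ m_j² < lo²`, `0 ≤ lo`
  (`eigenvalues₀_lt_of_frobenius`). With `s = {0,…,k}` this bounds `λ↓_{k+1}` by the ℓ²-mass the top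
  `k+1` levels leave over — computable matrix-free from `Σ_s ‖A e_s‖²` (`|S_e|` matrix–vector products).
* §3 `sub_le_eigenvalues₀_of_residual_of_above` — a residual ball whose eigenvalue cannot be one of the
  levels `j < k` (those are certified `> μ + ρ`) bounds level `k` from BELOW: `μ − ρ ≤ λ↓_k(A)`
  (Weinstein + antitonicity) — this supplies the `m_j` of §2 inductively, level by level.
* §4 `eigenvalues₀_mem_Icc_of_residual_of_frobenius` — the **SELF-ISOLATED LEVEL CERTIFICATE**: a
  residual ball for `(μ, x)`, the upper isolation `∀ j < k, μ + ρ < λ↓_j` (from the previously certified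
  levels, or vacuous for `k = 0`), lower bounds `0 ≤ m_j ≤ λ↓_j` for `j ≤ k`, a Frobenius bound `U` and
  the numerical test `U − Σ_{j≤k} m_j² < (μ − ρ)²` (`0 ≤ μ − ρ`) give `λ↓_k(A) ∈ [μ − ρ, μ + ρ]`;
  `eigenvalues₀_zero_mem_Icc_of_residual_of_frobenius` is the top-level (`k = 0`) instance whose only
  inputs are the residual ball, its own Rayleigh-type lower bound and `U`.

The transfer from the truncated operator `W_{S,T}` to `W_S` (`‖W_S − W_{S,T}‖ ≤ τ_P`, Weyl) and to the
FLOW-DATA object `W` (TAIL-A) is unchanged (`Literature.Analysis.Matrix.EigenvalueEnclosureTransport`,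
`KWeightTail`). References: Horn–Johnson, *Matrix Analysis* (2nd ed.), Thm 2.5.3 (c) (normal matrices:
`Σ|λ|² = ‖A‖_F²`), Thm 4.3.1 (Weyl), §6.3 (residual bounds); Parlett, *The Symmetric Eigenvalue
Problem*, §4.5, §10 (residual / trace bounds in Lanczos practice).
-/

open Matrix Finset WithLp

namespace Summit.Ventures.YMGap.FlowData

namespace FrobeniusDeflation

variable {n : Type*} [Fintype n] [DecidableEq n] {A : Matrix n n ℝ}

/-! ### §1 The Frobenius norm is the ℓ²-norm of the spectrum -/

/-- Re-indexing a sum over Mathlib's unsorted `eigenvalues` (indexed by `n`) as a sum over the sorted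
`eigenvalues₀` (indexed by `Fin (card n)`); `eigenvalues = eigenvalues₀ ∘ e.symm` by definition.
[cite: HornJohnson2013, Thm 2.5.3 (c)] -/
theorem sum_comp_eigenvalues_eq_sum_comp_eigenvalues₀ (hA : A.IsHermitian) (f : ℝ → ℝ) :
    ∑ i, f (hA.eigenvalues i) = ∑ j, f (hA.eigenvalues₀ j) := by
  unfold Matrix.IsHermitian.eigenvalues
  exact Equiv.sum_comp (Fintype.equivOfCardEq (Fintype.card_fin _)).symm (fun j => f (hA.eigenvalues₀ j))

omit [Fintype n] [DecidableEq n] in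
/-- A real Hermitian matrix is symmetric entrywise: `A l i = A i l`. [cite: HornJohnson2013, §4.1] -/
theorem apply_swap_of_isHermitian (hA : A.IsHermitian) (i l : n) : A l i = A i l := by
  have h := congrFun (congrFun hA i) l
  simpa [conjTranspose_apply] using h

/-- `tr(A²) = Σ_{i,l} A_{il}²` for a real symmetric matrix. [cite: HornJohnson2013, §2.5] -/
theorem trace_sq_eq_sum_sq (hA : A.IsHermitian) : (A ^ 2).trace = ∑ i, ∑ l, A i l ^ 2 := by
  rw [pow_two, Matrix.trace]
  simp only [Matrix.diag, Matrix.mul_apply]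
  refine sum_congr rfl fun i _ => sum_congr rfl fun l _ => ?_
  rw [apply_swap_of_isHermitian hA i l, pow_two]

/-- **`‖A‖_F² = Σ_j λ↓_j(A)²`**: the sum of the squared entries of a real symmetric matrix is the sum of
its squared eigenvalues (spectral theorem; the normal-matrix case of Schur's inequality with equality).
[cite: HornJohnson2013, Thm 2.5.3 (c)] -/
theorem sum_sq_eq_sum_eigenvalues₀_sq (hA : A.IsHermitian) :
    ∑ i, ∑ l, A i l ^ 2 = ∑ j, hA.eigenvalues₀ j ^ 2 := by
  rw [← trace_sq_eq_sum_sq hA, Literature.LinearAlgebra.Matrix.trace_pow_eq_sum hA 2]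
  exact sum_comp_eigenvalues_eq_sum_comp_eigenvalues₀ hA (fun x => x ^ 2)

/-- Consequently every single eigenvalue is bounded by the Frobenius norm: `λ↓_j(A)² ≤ Σ_{i,l} A_{il}²`.
[cite: HornJohnson2013, Thm 2.5.3 (c)] -/
theorem eigenvalues₀_sq_le_sum_sq (hA : A.IsHermitian) (j : Fin (Fintype.card n)) :
    hA.eigenvalues₀ j ^ 2 ≤ ∑ i, ∑ l, A i l ^ 2 := by
  rw [sum_sq_eq_sum_eigenvalues₀_sq hA]
  exact single_le_sum (f := fun j => hA.eigenvalues₀ j ^ 2) (fun j _ => sq_nonneg _) (mem_univ j)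

/-! ### §2 The Frobenius deflation bound -/

/-- **FROBENIUS DEFLATION BOUND.** If `Σ_{i,l} A_{il}² ≤ U` and `0 ≤ m_j ≤ λ↓_j(A)` for every `j` in a
finite index set `s`, then for every index `j₁ ∉ s`: `λ↓_{j₁}(A)² ≤ U − Σ_{j∈s} m_j²` — the ℓ²-mass of
the spectrum not already claimed by the certified lower bounds dominates every other eigenvalue.
[cite: HornJohnson2013, Thm 2.5.3 (c)] -/
theorem eigenvalues₀_sq_le_of_frobenius (hA : A.IsHermitian) (j₁ : Fin (Fintype.card n))
    (s : Finset (Fin (Fintype.card n))) (hs : j₁ ∉ s) {m : Fin (Fintype.card n) → ℝ}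
    (hm0 : ∀ j ∈ s, 0 ≤ m j) (hm : ∀ j ∈ s, m j ≤ hA.eigenvalues₀ j) {U : ℝ}
    (hU : ∑ i, ∑ l, A i l ^ 2 ≤ U) :
    hA.eigenvalues₀ j₁ ^ 2 ≤ U - ∑ j ∈ s, m j ^ 2 := by
  have htot : ∑ j, hA.eigenvalues₀ j ^ 2 ≤ U := by
    rw [← sum_sq_eq_sum_eigenvalues₀_sq hA]; exact hU
  have h1 : ∑ j ∈ s, m j ^ 2 ≤ ∑ j ∈ s, hA.eigenvalues₀ j ^ 2 :=
    sum_le_sum fun j hj => pow_le_pow_left₀ (hm0 j hj) (hm j hj) 2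
  have h2 : ∑ j ∈ insert j₁ s, hA.eigenvalues₀ j ^ 2 ≤ ∑ j, hA.eigenvalues₀ j ^ 2 :=
    sum_le_sum_of_subset_of_nonneg (subset_univ _) (fun j _ _ => sq_nonneg _)
  rw [sum_insert hs] at h2
  linarith

/-- Square-root form: `λ↓_{j₁}(A) ≤ √(U − Σ_{j∈s} m_j²)`. [cite: HornJohnson2013, Thm 2.5.3 (c)] -/
theorem eigenvalues₀_le_sqrt_of_frobenius (hA : A.IsHermitian) (j₁ : Fin (Fintype.card n))
    (s : Finset (Fin (Fintype.card n))) (hs : j₁ ∉ s) {m : Fin (Fintype.card n) → ℝ}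
    (hm0 : ∀ j ∈ s, 0 ≤ m j) (hm : ∀ j ∈ s, m j ≤ hA.eigenvalues₀ j) {U : ℝ}
    (hU : ∑ i, ∑ l, A i l ^ 2 ≤ U) :
    hA.eigenvalues₀ j₁ ≤ Real.sqrt (U - ∑ j ∈ s, m j ^ 2) := by
  have h := eigenvalues₀_sq_le_of_frobenius hA j₁ s hs hm0 hm hU
  calc hA.eigenvalues₀ j₁ ≤ |hA.eigenvalues₀ j₁| := le_abs_self _
    _ = Real.sqrt (hA.eigenvalues₀ j₁ ^ 2) := (Real.sqrt_sq_eq_abs _).symm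
    _ ≤ Real.sqrt (U - ∑ j ∈ s, m j ^ 2) := Real.sqrt_le_sqrt h

/-- Checker form: `U − Σ_{j∈s} m_j² < lo²` with `0 ≤ lo` certifies `λ↓_{j₁}(A) < lo` for every `j₁ ∉ s`
(the numerical test the matrix-free driver performs with outward-rounded floats).
[cite: HornJohnson2013, Thm 2.5.3 (c)] -/
theorem eigenvalues₀_lt_of_frobenius (hA : A.IsHermitian) (j₁ : Fin (Fintype.card n))
    (s : Finset (Fin (Fintype.card n))) (hs : j₁ ∉ s) {m : Fin (Fintype.card n) → ℝ}
    (hm0 : ∀ j ∈ s, 0 ≤ m j) (hm : ∀ j ∈ s, m j ≤ hA.eigenvalues₀ j) {U lo : ℝ}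
    (hU : ∑ i, ∑ l, A i l ^ 2 ≤ U) (hlo : 0 ≤ lo) (hlt : U - ∑ j ∈ s, m j ^ 2 < lo ^ 2) :
    hA.eigenvalues₀ j₁ < lo :=
  lt_of_pow_lt_pow_left₀ 2 hlo ((eigenvalues₀_sq_le_of_frobenius hA j₁ s hs hm0 hm hU).trans_lt hlt)

/-- The deflation bound for the SUCCESSOR index, in the shape the level certificate consumes: with
`s = {j : j ≤ k}` and `k + 1` an index, `U − Σ_{j ≤ k} m_j² < lo²` gives `λ↓_j(A) < lo` for ALL `j > k`
(antitone spectrum). [cite: HornJohnson2013, Thm 2.5.3 (c); Thm 4.3.1] -/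
theorem forall_lt_of_frobenius (hA : A.IsHermitian) (k : Fin (Fintype.card n))
    {m : Fin (Fintype.card n) → ℝ} (hm0 : ∀ j, j ≤ k → 0 ≤ m j)
    (hm : ∀ j, j ≤ k → m j ≤ hA.eigenvalues₀ j) {U lo : ℝ} (hU : ∑ i, ∑ l, A i l ^ 2 ≤ U)
    (hlo : 0 ≤ lo) (hlt : U - ∑ j ∈ univ.filter (· ≤ k), m j ^ 2 < lo ^ 2) :
    ∀ j, k < j → hA.eigenvalues₀ j < lo := by
  intro j hj
  have hjs : j ∉ univ.filter (· ≤ k) := by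
    simp only [mem_filter, mem_univ, true_and, not_le]; exact hj
  exact eigenvalues₀_lt_of_frobenius hA j _ hjs (fun i hi => hm0 i (by simpa using hi))
    (fun i hi => hm i (by simpa using hi)) hU hlo hlt

/-! ### §3 Lower bound for level `k` from a residual ball isolated from above -/

/-- A residual ball `‖A x − μ x‖ ≤ ρ‖x‖` contains SOME eigenvalue (Weinstein); if the levels `j < k` are
all certified `> μ + ρ`, that eigenvalue has index `≥ k`, so `μ − ρ ≤ λ↓_k(A)` (antitone spectrum). For
`k = 0` the hypothesis is vacuous (the top eigenvalue dominates every eigenvalue in the ball).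
[cite: HornJohnson2013, Thm 6.3.14] -/
theorem sub_le_eigenvalues₀_of_residual_of_above (hA : A.IsHermitian) (k : Fin (Fintype.card n))
    {x : n → ℝ} (hx : x ≠ 0) {μ ρ : ℝ}
    (hres : ‖toEuclideanLin A (toLp 2 x) - μ • toLp 2 x‖ ≤ ρ * ‖toLp 2 x‖)
    (habove : ∀ j, j < k → μ + ρ < hA.eigenvalues₀ j) :
    μ - ρ ≤ hA.eigenvalues₀ k := by
  obtain ⟨j, hj⟩ := MatrixFreeLevel.exists_abs_eigenvalues₀_sub_le_of_norm_le hA hx hres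
  have hjlo : μ - ρ ≤ hA.eigenvalues₀ j := by linarith [(abs_le.1 hj).1]
  have hjhi : hA.eigenvalues₀ j ≤ μ + ρ := by linarith [(abs_le.1 hj).2]
  have hkj : k ≤ j := by
    by_contra h
    exact absurd (habove j (lt_of_not_ge h)) (not_lt.2 hjhi)
  exact hjlo.trans (hA.eigenvalues₀_antitone hkj)

/-- Top-level instance: `μ − ρ ≤ λ↓_0(A)` from any residual ball (no isolation needed).
[cite: HornJohnson2013, Thm 6.3.14] -/
theorem sub_le_eigenvalues₀_zero_of_residual (hA : A.IsHermitian) (k : Fin (Fintype.card n))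
    (hk : (k : ℕ) = 0) {x : n → ℝ} (hx : x ≠ 0) {μ ρ : ℝ}
    (hres : ‖toEuclideanLin A (toLp 2 x) - μ • toLp 2 x‖ ≤ ρ * ‖toLp 2 x‖) :
    μ - ρ ≤ hA.eigenvalues₀ k :=
  sub_le_eigenvalues₀_of_residual_of_above hA k hx hres (MatrixFreeLevel.forall_gt_of_val_eq_zero hk)

/-! ### §4 The self-isolated level certificate -/

/-- **SELF-ISOLATED LEVEL CERTIFICATE (route O without a dense reference).** Inputs, all from the
matrix-free run itself: a residual ball `‖A x − μ x‖ ≤ ρ‖x‖` (`x ≠ 0`, `0 ≤ μ − ρ`); the upper isolation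
`∀ j < k, μ + ρ < λ↓_j(A)` (from the previously certified levels; vacuous for `k = 0`); certified lower
bounds `0 ≤ m_j ≤ λ↓_j(A)` for `j ≤ k` (§3, level by level — `m_k = μ − ρ` itself qualifies); a Frobenius
bound `Σ_{i,l} A_{il}² ≤ U` (from `Σ_s ‖A e_s‖²`); and the test `U − Σ_{j≤k} m_j² < (μ − ρ)²`. Then
`λ↓_k(A) ∈ [μ − ρ, μ + ρ]`. [cite: HornJohnson2013, Thm 6.3.14; Thm 2.5.3 (c)] -/
theorem eigenvalues₀_mem_Icc_of_residual_of_frobenius (hA : A.IsHermitian) (k : Fin (Fintype.card n))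
    {x : n → ℝ} (hx : x ≠ 0) {μ ρ : ℝ}
    (hres : ‖toEuclideanLin A (toLp 2 x) - μ • toLp 2 x‖ ≤ ρ * ‖toLp 2 x‖)
    (habove : ∀ j, j < k → μ + ρ < hA.eigenvalues₀ j)
    {m : Fin (Fintype.card n) → ℝ} (hm0 : ∀ j, j ≤ k → 0 ≤ m j)
    (hm : ∀ j, j ≤ k → m j ≤ hA.eigenvalues₀ j) {U : ℝ} (hU : ∑ i, ∑ l, A i l ^ 2 ≤ U)
    (hlo : 0 ≤ μ - ρ) (hlt : U - ∑ j ∈ univ.filter (· ≤ k), m j ^ 2 < (μ - ρ) ^ 2) :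
    hA.eigenvalues₀ k ∈ Set.Icc (μ - ρ) (μ + ρ) :=
  MatrixFreeLevel.eigenvalues₀_mem_Icc_of_residual_of_isolated hA k hx hres
    (forall_lt_of_frobenius hA k hm0 hm hU hlo hlt) habove

/-- **Top level, self-isolated** (`k = 0`: a sector top / the vacuum eigenvalue): a residual ball with
`0 ≤ μ − ρ`, a Frobenius bound `U`, and the dominance test `U − (μ − ρ)² < (μ − ρ)²` (the top's own lower
bound `m_0 = μ − ρ` from §3) give `λ↓_0(A) ∈ [μ − ρ, μ + ρ]` — no reference computation, no second trial
vector. [cite: HornJohnson2013, Thm 6.3.14; Thm 2.5.3 (c)] -/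
theorem eigenvalues₀_zero_mem_Icc_of_residual_of_frobenius (hA : A.IsHermitian)
    (k : Fin (Fintype.card n)) (hk : (k : ℕ) = 0) {x : n → ℝ} (hx : x ≠ 0) {μ ρ : ℝ}
    (hres : ‖toEuclideanLin A (toLp 2 x) - μ • toLp 2 x‖ ≤ ρ * ‖toLp 2 x‖)
    {U : ℝ} (hU : ∑ i, ∑ l, A i l ^ 2 ≤ U) (hlo : 0 ≤ μ - ρ)
    (hlt : U - (μ - ρ) ^ 2 < (μ - ρ) ^ 2) :
    hA.eigenvalues₀ k ∈ Set.Icc (μ - ρ) (μ + ρ) := by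
  have habove : ∀ j, j < k → μ + ρ < hA.eigenvalues₀ j := MatrixFreeLevel.forall_gt_of_val_eq_zero hk
  have hfilter : univ.filter (· ≤ k) = {k} := by
    ext j
    simp only [mem_filter, mem_univ, true_and, mem_singleton]
    constructor
    · intro h
      exact Fin.le_antisymm h (Fin.le_def.2 (by simp [hk]))
    · intro h
      exact h ▸ le_rfl
  refine eigenvalues₀_mem_Icc_of_residual_of_frobenius hA k hx hres habove (m := fun _ => μ - ρ)
    (fun j _ => hlo) (fun j hj => ?_) hU hlo (by rw [hfilter, sum_singleton]; exact hlt)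
  have hjk : j = k := Fin.le_antisymm hj (Fin.le_def.2 (by simp [hk]))
  rw [hjk]
  exact sub_le_eigenvalues₀_of_residual_of_above hA k hx hres habove

/-- **Second level, self-isolated** (`k = 1`: e.g. the mass-gap level of the vacuum block): the top
level already certified in `[lo₀, hi₀]` with `μ + ρ < lo₀` (upper isolation and `m_0 = lo₀ ≥ 0`), a
residual ball for `(μ, x)` with `0 ≤ μ − ρ`, a Frobenius bound `U`, and the test
`U − lo₀² − (μ − ρ)² < (μ − ρ)²` give `λ↓_1(A) ∈ [μ − ρ, μ + ρ]`.
[cite: HornJohnson2013, Thm 6.3.14; Thm 2.5.3 (c)] -/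
theorem eigenvalues₀_one_mem_Icc_of_residual_of_frobenius (hA : A.IsHermitian)
    (k j₀ : Fin (Fintype.card n)) (hj₀ : (j₀ : ℕ) = 0) (hk : (k : ℕ) = 1) {x : n → ℝ} (hx : x ≠ 0)
    {μ ρ lo₀ : ℝ} (hres : ‖toEuclideanLin A (toLp 2 x) - μ • toLp 2 x‖ ≤ ρ * ‖toLp 2 x‖)
    (hlo₀ : lo₀ ≤ hA.eigenvalues₀ j₀) (hsep : μ + ρ < lo₀) (hlo₀0 : 0 ≤ lo₀)
    {U : ℝ} (hU : ∑ i, ∑ l, A i l ^ 2 ≤ U) (hlo : 0 ≤ μ - ρ)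
    (hlt : U - lo₀ ^ 2 - (μ - ρ) ^ 2 < (μ - ρ) ^ 2) :
    hA.eigenvalues₀ k ∈ Set.Icc (μ - ρ) (μ + ρ) := by
  -- upper isolation: the only index below `k = 1` is `j₀ = 0`
  have habove : ∀ j, j < k → μ + ρ < hA.eigenvalues₀ j := by
    intro j hj
    have hj0 : j = j₀ := Fin.ext (by have := Fin.lt_def.1 hj; omega)
    rw [hj0]; exact hsep.trans_le hlo₀
  have hk0 : j₀ ≤ k := Fin.le_def.2 (by omega)
  have hne : j₀ ≠ k := fun h => by have := congrArg Fin.val h; omega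
  -- the index set `{j ≤ k} = {j₀, k}`
  have hfilter : univ.filter (· ≤ k) = {j₀, k} := by
    ext j
    simp only [mem_filter, mem_univ, true_and, mem_insert, mem_singleton]
    constructor
    · intro h
      have := Fin.le_def.1 h
      by_cases hj : (j : ℕ) = 0
      · exact Or.inl (Fin.ext (by omega))
      · exact Or.inr (Fin.ext (by omega))
    · rintro (h | h)
      · exact h ▸ hk0
      · exact h ▸ le_rfl
  let m : Fin (Fintype.card n) → ℝ := fun j => if j = j₀ then lo₀ else μ - ρ
  have hm0 : ∀ j, j ≤ k → 0 ≤ m j := by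
    intro j _; by_cases h : j = j₀ <;> simp [m, h, hlo₀0, hlo]
  have hm : ∀ j, j ≤ k → m j ≤ hA.eigenvalues₀ j := by
    intro j hj
    by_cases h : j = j₀
    · simp only [m, h, if_true]; exact hlo₀
    · have hjk : j = k := by
        have h1 := Fin.le_def.1 hj
        have h2 : (j : ℕ) ≠ 0 := fun h0 => h (Fin.ext (by omega))
        exact Fin.ext (by omega)
      simp only [m, h, if_false]
      rw [hjk]
      exact sub_le_eigenvalues₀_of_residual_of_above hA k hx hres habove
  have hsum : ∑ j ∈ univ.filter (· ≤ k), m j ^ 2 = lo₀ ^ 2 + (μ - ρ) ^ 2 := by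
    rw [hfilter, sum_pair hne]
    simp [m, hne.symm]
  exact eigenvalues₀_mem_Icc_of_residual_of_frobenius hA k hx hres habove hm0 hm hU hlo
    (by rw [hsum]; linarith)

end FrobeniusDeflation

end Summit.Ventures.YMGap.FlowData
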